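import Summits.QuantumFields.BalabanUV.T4Continuum.Support.NE7CurvedLiftBookkeepingTwoTerm
import HarnessLib

/-!
# NE7CurvedLiftBookkeepingApproxHomTwoTerm — THE SOCKET FOR THE RE-THREAD: the END chain's actual root `NE7CurvedLiftBookkeepingApprox.smallField_vary_of_curvedLetters_approxNorth`
# (approximate Hessian orthogonality `ν` of the normal part, as F111 supplies it) RE-CUT with the HOMOGENEOUS two-term slice-solver letter `‖curlAt W X‖ ≤ K_G·g + K_X·R`: the functional
# bound `(τ + ρ + κ + ν)` of `A − A_N` EXPORTED, and the conclusion `SmallField (We^{A}) (x + (K_G(τ + ρ + κ + ν) + K_X(α₀ + a_N) + c_N + 28α₀²))` (file 65 of the curved (APE))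

Cell `pub-balaban`, rung (B)+1 sub-cell t4, lineage `b2b-balaban-t4-ne7-p1` (CRUX PROVER NE7 #1 = OWNER of row NE7), generation 80; memo
`t4/b2b-balaban-t4-ne7-p1-g80/SLICE-LETTER-OBSTRUCTION.md` §3 PS.  File F135, over F131 `NE7CurvedLiftBookkeepingTwoTerm.smallField_vary_of_curl` and the proof of the chain root
`NE7CurvedLiftBookkeepingApprox.smallField_vary_of_curvedLetters_approxNorth` (gen 76; the file that `NE7ApeCurvedRepDockingStrong` → … → F123d actually sit on).
WHY.  F134 gave the homogeneous socket for F55's exact-North root; the live END chain uses the APPROXIMATE-North root (F111's normal lift has `|hess W A_N Y| ≤ ν‖Y‖₁`, not `= 0`).  The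
successor's re-thread (memo §3 (v)) starts HERE: replace `smallField_vary_of_curvedLetters_approxNorth` by `smallField_vary_of_curvedLetters_approxHomTwoTerm` in
`NE7ApeCurvedRepDockingStrong` and carry `K_X·(α₀ + a_N)` next to `c_N` through `…DockingPriced → …SameTop → …SameTopCritical → …PointedGauge → …RoadB → …RoadBLifted (a_N := m) →
…RoadBFinal → …RoadBSharp → …RoadBGradientSharp → …M → …Class`, NEVER re-introducing a one-term `hG`; `hS ⊇ {tangent skew periodic}` may stay (the homogeneous letter is consistent
with it: F132 on gauge modes, F128's lower bound is a bound on `K_X`, not a contradiction).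
WHAT ([folklore]; 0 def, 0 sorry).  §1 **`hess_functional_of_curvedLetters_approx`** (hNorth-approx + hEXP + hWten + hcrit + hTT ⟹ `|hess W (A − A_N) Y| ≤ (τ+ρ+κ+ν)‖Y‖₁` on tangent
`Y`; `A − A_N` periodic tangent); §2 **`smallField_vary_of_curvedLetters_approxHomTwoTerm`**.
HONEST FRAMING (page 1): bookkeeping over DISPLAYED letters at one configuration; the homogeneous two-term letter is a HYPOTHESIS SHAPE (B9 material at curved `W`, not in the tree);
nothing of Bałaban's asserted; (APE) on curved data NOT proved; NOT ONE-STEP, NOT NE7; spine 0∕9; finite T⁴ rung (B)+1 — NOT infinite volume, NOT mass gap, NOT `BetaPertH`, NOT Clay.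
Continuum YM on T⁴ ⇐ BetaPertH ∧ nine spine estimates (0/9 proved); BetaPertH ⇐ (D1) ∧ (D4) ∧ CAP+tail; G-an2-4 gates asym, D1 and NE2/3/4.
-/

set_option autoImplicit false

open scoped BigOperators Matrix Matrix.Norms.L2Operator
open NormedSpace Finset Set

namespace Summit.QuantumFields.BalabanUV.T4Continuum.NE7CurvedLiftBookkeepingApproxHomTwoTerm

open Literature.MathematicalPhysics.QuantumFieldTheory.Balaban1983to89
open B7Prop1Explicit B7Prop2Explicit MatrixLog UnitaryModel
open T4AveragingDeficitWall (IsUnitaryCfg IsSkewDir SmallField vary curlAt dirL1 vary_zero)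
open T4AveragingDeficitWallBoundary (IsPeriodicCfg periodBox)
open AveragingDeficitPeriodicCounting (IsPeriodicDir)
open AveragingDeficitMultiLevelPrep (LevelSmall)
open MinimalActionLevels (perWin)
open NE3HessForm (hess dAction)
open NE3TangentCovariantTower (dirIter)
open NE3ResidualSliceRep (dirIter_sub)
open NE3EnergyHessBilin (hess_add_left curlAt_add)
open NE7ExactCurrent (dAction_add)
open NE7CurvedLiftBookkeepingTwoTerm (smallField_vary_of_curl)

noncomputable section

variable {d : ℕ} {n : Type*} [Fintype n] [DecidableEq n]

/-! ## §1 The slice functional bound of `A − A_N` with an approximately orthogonal normal part -/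

/-- **THE SLICE FUNCTIONAL BOUND OF `X = A − A_N`, APPROXIMATE NORTH**: hNorth-approx (`|hess W A_N Y| ≤ ν‖Y‖₁` on tangent `Y`), hEXP (`ρ`), hWten (`κ`), hcrit, hTT (`τ`) ⟹ for every
skew `P`-periodic `W`-tangent `Y`, `|hess W X Y (perWin d P)| ≤ (τ + ρ + κ + ν)·dirL1 Y (periodBox P)`; `X` is periodic and tangent. (The chain root's internal step, exported.) [folklore] -/
theorem hess_functional_of_curvedLetters_approx [Nonempty n] {L : ℕ} (hL : 1 ≤ L) (k : ℕ) {P : ℕ}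
    {W : Site d → Fin d → (Matrix n n ℂ)ˣ} (hW : IsUnitaryCfg W)
    {x : ℝ} (hx : 0 ≤ x) (hs : LevelSmall d L k x) (hWx : SmallField W x)
    (A : Site d → Fin d → Matrix n n ℂ) (hAP : IsPeriodicDir A (P : ℤ))
    {AN : Site d → Fin d → Matrix n n ℂ} (hNP : IsPeriodicDir AN (P : ℤ))
    (hNexact : dirIter L (k + 1) W AN = dirIter L (k + 1) W A)
    {ν : ℝ}
    (hNorth : ∀ Y : Site d → Fin d → Matrix n n ℂ, IsSkewDir Y → IsPeriodicDir Y (P : ℤ) → dirIter L (k + 1) W Y = 0 →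
      |hess W AN Y (perWin d P)| ≤ ν * dirL1 Y (periodBox (d := d) P))
    {ρ : ℝ}
    (hEXP : ∀ Y : Site d → Fin d → Matrix n n ℂ, IsSkewDir Y → IsPeriodicDir Y (P : ℤ) →
      |dAction (vary W A 1) Y (perWin d P) - dAction W Y (perWin d P) - hess W A Y (perWin d P)| ≤ ρ * dirL1 Y (periodBox (d := d) P))
    {κ : ℝ}
    (hWten : ∀ Y : Site d → Fin d → Matrix n n ℂ, IsSkewDir Y → IsPeriodicDir Y (P : ℤ) → dirIter L (k + 1) W Y = 0 →
      |dAction W Y (perWin d P)| ≤ κ * dirL1 Y (periodBox (d := d) P))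
    (hcrit : ∀ Y' : Site d → Fin d → Matrix n n ℂ, IsSkewDir Y' → IsPeriodicDir Y' (P : ℤ) → dirIter L (k + 1) (vary W A 1) Y' = 0 →
      dAction (vary W A 1) Y' (perWin d P) = 0)
    {τ : ℝ}
    (hTT : ∀ Y : Site d → Fin d → Matrix n n ℂ, IsSkewDir Y → IsPeriodicDir Y (P : ℤ) → dirIter L (k + 1) W Y = 0 →
      ∃ Y' : Site d → Fin d → Matrix n n ℂ, IsSkewDir Y' ∧ IsPeriodicDir Y' (P : ℤ) ∧ dirIter L (k + 1) (vary W A 1) Y' = 0 ∧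
        |dAction (vary W A 1) (fun y μ => Y' y μ - Y y μ) (perWin d P)| ≤ τ * dirL1 Y (periodBox (d := d) P)) :
    IsPeriodicDir (fun y μ => A y μ - AN y μ) (P : ℤ) ∧ dirIter L (k + 1) W (fun y μ => A y μ - AN y μ) = 0 ∧
      ∀ Y : Site d → Fin d → Matrix n n ℂ, IsSkewDir Y → IsPeriodicDir Y (P : ℤ) → dirIter L (k + 1) W Y = 0 →
        |hess W (fun y μ => A y μ - AN y μ) Y (perWin d P)| ≤ (τ + ρ + κ + ν) * dirL1 Y (periodBox (d := d) P) := by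
  set X : Site d → Fin d → Matrix n n ℂ := fun y μ => A y μ - AN y μ with hXdef
  have hXP : IsPeriodicDir X (P : ℤ) := fun y i μ => by simp only [hXdef, hAP y i μ, hNP y i μ]
  have hXT : dirIter L (k + 1) W X = 0 := by
    rw [hXdef, dirIter_sub hL k hW hx hs hWx A AN, hNexact]
    funext z κ'
    simp
  have hsrc : ∀ Y : Site d → Fin d → Matrix n n ℂ, IsSkewDir Y → IsPeriodicDir Y (P : ℤ) → dirIter L (k + 1) W Y = 0 →
      |hess W X Y (perWin d P)| ≤ (τ + ρ + κ + ν) * dirL1 Y (periodBox (d := d) P) := by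
    intro Y hY hYP hYT
    have hsplitA : A = X + AN := by funext y μ; simp [hXdef]
    have hhess : hess W X Y (perWin d P) = hess W A Y (perWin d P) - hess W AN Y (perWin d P) := by
      have h := hess_add_left W (perWin d P) X AN Y
      rw [← hsplitA] at h
      linarith
    have hNν := hNorth Y hY hYP hYT
    obtain ⟨Y', hY's, hY'P, hY'T, hY'd⟩ := hTT Y hY hYP hYT
    have hc := hcrit Y' hY's hY'P hY'T
    have hdec : dAction (vary W A 1) Y (perWin d P)
        = dAction (vary W A 1) Y' (perWin d P) - dAction (vary W A 1) (fun y μ => Y' y μ - Y y μ) (perWin d P) := by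
      have hYsum : Y' = Y + fun y μ => Y' y μ - Y y μ := by funext y μ; simp
      have h := dAction_add (vary W A 1) Y (fun y μ => Y' y μ - Y y μ) (perWin d P)
      rw [← hYsum] at h
      linarith
    have hdA : |dAction (vary W A 1) Y (perWin d P)| ≤ τ * dirL1 Y (periodBox (d := d) P) := by
      rw [hdec, hc, zero_sub, abs_neg]
      exact hY'd
    have hE := hEXP Y hY hYP
    have hK := hWten Y hY hYP hYT
    have htri : |hess W A Y (perWin d P)| ≤ |dAction (vary W A 1) Y (perWin d P)|
        + |dAction (vary W A 1) Y (perWin d P) - dAction W Y (perWin d P) - hess W A Y (perWin d P)| + |dAction W Y (perWin d P)| := by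
      have h := abs_sub_le (hess W A Y (perWin d P)) (dAction (vary W A 1) Y (perWin d P) - dAction W Y (perWin d P)) 0
      have h1 : |hess W A Y (perWin d P) - (dAction (vary W A 1) Y (perWin d P) - dAction W Y (perWin d P))|
          = |dAction (vary W A 1) Y (perWin d P) - dAction W Y (perWin d P) - hess W A Y (perWin d P)| := by
        rw [abs_sub_comm]
      have h2 : |dAction (vary W A 1) Y (perWin d P) - dAction W Y (perWin d P) - 0|
          ≤ |dAction (vary W A 1) Y (perWin d P)| + |dAction W Y (perWin d P)| := by
        rw [sub_zero]; exact abs_sub _ _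
      rw [sub_zero] at h
      linarith
    have hAbd : |hess W A Y (perWin d P)|
        ≤ τ * dirL1 Y (periodBox (d := d) P) + ρ * dirL1 Y (periodBox (d := d) P) + κ * dirL1 Y (periodBox (d := d) P) := by linarith
    rw [hhess]
    calc |hess W A Y (perWin d P) - hess W AN Y (perWin d P)|
        ≤ |hess W A Y (perWin d P)| + |hess W AN Y (perWin d P)| := abs_sub _ _
      _ ≤ (τ * dirL1 Y (periodBox (d := d) P) + ρ * dirL1 Y (periodBox (d := d) P) + κ * dirL1 Y (periodBox (d := d) P))
          + ν * dirL1 Y (periodBox (d := d) P) := add_le_add hAbd hNν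
      _ = (τ + ρ + κ + ν) * dirL1 Y (periodBox (d := d) P) := by ring
  exact ⟨hXP, hXT, hsrc⟩

/-! ## §2 The chain root with the homogeneous two-term letter -/

/-- **THE CHAIN ROOT WITH THE HOMOGENEOUS TWO-TERM LETTER**: the hypotheses of `smallField_vary_of_curvedLetters_approxNorth`, a sup bound `a_N` of the normal part, and
`hG : ∀ X ∈ S` periodic tangent, `∀ R, (∀ y κ, ‖X y κ‖ ≤ R) → ∀ g ≥ 0, (functional ≤ g) → ‖curlAt W X z μ ν‖ ≤ K_G·g + K_X·R` ⟹
`SmallField (vary W A 1) (x + (K_G(τ + ρ + κ + ν) + K_X(α₀ + a_N) + c_N + 28α₀²))`. [folklore] -/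
theorem smallField_vary_of_curvedLetters_approxHomTwoTerm [Nonempty n] {L : ℕ} (hL : 1 ≤ L) (k : ℕ) {P : ℕ}
    {W : Site d → Fin d → (Matrix n n ℂ)ˣ} (hW : IsUnitaryCfg W)
    {x : ℝ} (hx : 0 ≤ x) (hs : LevelSmall d L k x) (hWx : SmallField W x)
    {A : Site d → Fin d → Matrix n n ℂ} (hA : IsSkewDir A) (hAP : IsPeriodicDir A (P : ℤ)) {α₀ : ℝ} (hAα : ∀ y μ, ‖A y μ‖ ≤ α₀)
    {AN : Site d → Fin d → Matrix n n ℂ} (hNP : IsPeriodicDir AN (P : ℤ)) {aN : ℝ} (hNsup : ∀ y μ, ‖AN y μ‖ ≤ aN)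
    (hNexact : dirIter L (k + 1) W AN = dirIter L (k + 1) W A)
    {cN : ℝ} (hN7 : ∀ z μ' ν', μ' ≠ ν' → ‖curlAt W AN z μ' ν'‖ ≤ cN)
    {ν : ℝ} (hν : 0 ≤ ν)
    (hNorth : ∀ Y : Site d → Fin d → Matrix n n ℂ, IsSkewDir Y → IsPeriodicDir Y (P : ℤ) → dirIter L (k + 1) W Y = 0 →
      |hess W AN Y (perWin d P)| ≤ ν * dirL1 Y (periodBox (d := d) P))
    (S : Set (Site d → Fin d → Matrix n n ℂ)) (hTS : (fun y μ => A y μ - AN y μ) ∈ S) {KG KX : ℝ}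
    (hG : ∀ X ∈ S, IsPeriodicDir X (P : ℤ) → dirIter L (k + 1) W X = 0 → ∀ R : ℝ, (∀ y κ', ‖X y κ'‖ ≤ R) → ∀ g : ℝ, 0 ≤ g →
      (∀ Y : Site d → Fin d → Matrix n n ℂ, IsSkewDir Y → IsPeriodicDir Y (P : ℤ) → dirIter L (k + 1) W Y = 0 →
        |hess W X Y (perWin d P)| ≤ g * dirL1 Y (periodBox (d := d) P)) →
      ∀ z μ' ν', μ' ≠ ν' → ‖curlAt W X z μ' ν'‖ ≤ KG * g + KX * R)
    {ρ : ℝ} (hρ : 0 ≤ ρ)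
    (hEXP : ∀ Y : Site d → Fin d → Matrix n n ℂ, IsSkewDir Y → IsPeriodicDir Y (P : ℤ) →
      |dAction (vary W A 1) Y (perWin d P) - dAction W Y (perWin d P) - hess W A Y (perWin d P)| ≤ ρ * dirL1 Y (periodBox (d := d) P))
    {κ : ℝ} (hκ : 0 ≤ κ)
    (hWten : ∀ Y : Site d → Fin d → Matrix n n ℂ, IsSkewDir Y → IsPeriodicDir Y (P : ℤ) → dirIter L (k + 1) W Y = 0 →
      |dAction W Y (perWin d P)| ≤ κ * dirL1 Y (periodBox (d := d) P))
    (hcrit : ∀ Y' : Site d → Fin d → Matrix n n ℂ, IsSkewDir Y' → IsPeriodicDir Y' (P : ℤ) → dirIter L (k + 1) (vary W A 1) Y' = 0 →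
      dAction (vary W A 1) Y' (perWin d P) = 0)
    {τ : ℝ} (hτ : 0 ≤ τ)
    (hTT : ∀ Y : Site d → Fin d → Matrix n n ℂ, IsSkewDir Y → IsPeriodicDir Y (P : ℤ) → dirIter L (k + 1) W Y = 0 →
      ∃ Y' : Site d → Fin d → Matrix n n ℂ, IsSkewDir Y' ∧ IsPeriodicDir Y' (P : ℤ) ∧ dirIter L (k + 1) (vary W A 1) Y' = 0 ∧
        |dAction (vary W A 1) (fun y μ => Y' y μ - Y y μ) (perWin d P)| ≤ τ * dirL1 Y (periodBox (d := d) P)) :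
    SmallField (vary W A 1) (x + (KG * (τ + ρ + κ + ν) + KX * (α₀ + aN) + cN + 28 * α₀ ^ 2)) := by
  obtain ⟨hXP, hXT, hsrc⟩ := hess_functional_of_curvedLetters_approx hL k hW hx hs hWx A hAP hNP hNexact hNorth hEXP hWten hcrit hTT
  have hXsup : ∀ y κ', ‖(fun y μ => A y μ - AN y μ) y κ'‖ ≤ α₀ + aN := fun y κ' =>
    (norm_sub_le _ _).trans (add_le_add (hAα y κ') (hNsup y κ'))
  have hcurlX : ∀ z μ' ν', μ' ≠ ν' → ‖curlAt W (fun y κ' => A y κ' - AN y κ') z μ' ν'‖ ≤ KG * (τ + ρ + κ + ν) + KX * (α₀ + aN) :=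
    hG _ hTS hXP hXT (α₀ + aN) hXsup (τ + ρ + κ + ν) (add_nonneg (add_nonneg (add_nonneg hτ hρ) hκ) hν) hsrc
  have h := smallField_vary_of_curl hW hWx hA hAα hN7 hcurlX
  have heq : x + (KG * (τ + ρ + κ + ν) + KX * (α₀ + aN) + cN + 28 * α₀ ^ 2)
      = x + ((KG * (τ + ρ + κ + ν) + KX * (α₀ + aN)) + cN + 28 * α₀ ^ 2) := by ring
  rw [heq]
  exact h

end

end Summit.QuantumFields.BalabanUV.T4Continuum.NE7CurvedLiftBookkeepingApproxHomTwoTerm
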